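import Literature.Probability.LatticeModels.SquareTilingUniformization
import Literature.Probability.Percolation.BoxCrossingProofs
import Literature.Probability.RandomPlanarGeometry.EllipticKAGM
import Literature.Probability.RandomPlanarGeometry.RectangleModulusAspectRatio
import Literature.NumberTheory.ModularForms.EisensteinLevelTwoHypergeometric

/-!
# The uniformizing rectangle of a conformal rectangle, with its modulus (part 1 of 2)

Support file for `KirchhoffExtremalLength` (route CardyUSTContinuation of `CardyFormulaZ2`,
item stmt-CriticalPhenomena-11234), continuum side of conjunct 2: for every conformal rectangle
`R = (Ω; a, b, c, d)` and every uniformizing datum `(φ, x)`,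

  `d_Ω((ab), (cd))⁻¹ = ₂F₁(½,½;1;η) / ₂F₁(½,½;1;1-η)`,   `η = crossRatio x`,

i.e. the reciprocal of Ahlfors' extremal distance between the arcs `(ab) = R.arc 0` and
`(cd) = R.arc 2` (`Literature.Analysis.Complex.extremalDistance`) is the ratio of complete
elliptic integrals `K(η)/K(1-η)` (`ellipticK_eq_hypergeometric`). Ingredients, all from the
tree: the uniformizing rectangle `(0, 2K(k²)) × (0, K(1-k²))` of `R` (Schwarz–Christoffel,
Carathéodory: `SquareTiling.exists_uniformizer` and the side analysis of
`SquareTiling.exists_rect_uniformizer`, here redone keeping track of the modulus `k`), whose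
cross-ratio is `((1-k)/(1+k))²` (`crossRatio_scrPrevertex`, conformal invariance of the
cross-ratio `crossRatio_eq_of_isUniformizing_holds`); the extremal distance `a/b` of a rectangle
and its conformal invariance (`extremalDistance_rectangle`, `extremalDistance_image_eq`); and the
two Landen identities `K(((1-k)/(1+k))²) = ((1+k)/2) K(1-k²)`, `K(4k/(1+k)²) = (1+k) K(k²)`
from Gauss's AGM invariance (`gaussAGMIntegral_agm_step`).
-/

noncomputable section

namespace Summit.CriticalPhenomena.CardyFormulaZ2.Theorems

namespace ModulusIdentification

open Set Filter Topology Complex Metric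
open Literature.Probability.RandomPlanarGeometry Literature.Probability.LatticeModels
open Literature.Probability.LatticeModels.SquareTiling
open UpperHalfPlane (upperHalfPlaneSet)

/-! ### §1. Landen's transformation and the hypergeometric ratio -/

/-- **Landen (descending)**: `K(((1-k)/(1+k))²) = ((1+k)/2)·K(1-k²)` in the parameter convention
`K(u) = ∫₀¹ dt/√((1-t²)(1-ut²))`, from Gauss's invariance `I((1+k)/2, √k) = I(1, k)`.
[cite: BorweinBorwein1987, Thm 1.2] -/
theorem ellipticK_landen_sq {k : ℝ} (hk0 : 0 < k) (hk1 : k < 1) :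
    ellipticK ((1 - k) ^ 2 / (1 + k) ^ 2) = (1 + k) / 2 * ellipticK (1 - k ^ 2) := by
  have h := gaussAGMIntegral_agm_step (a := 1) (b := k) one_pos hk0
  have hm : 0 < (1 + k) / 2 := by linarith
  rw [gaussAGMIntegral_eq_ellipticK hm (Real.sqrt_pos.2 (by linarith)),
    gaussAGMIntegral_eq_ellipticK one_pos hk0, Real.sq_sqrt (by linarith)] at h
  have h1k : (1 + k) / 2 ≠ 0 := hm.ne'
  have e1 : 1 - k / ((1 + k) / 2) ^ 2 = (1 - k) ^ 2 / (1 + k) ^ 2 := by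
    field_simp
    ring
  have e2 : (1 : ℝ) - k ^ 2 / 1 ^ 2 = 1 - k ^ 2 := by ring
  rw [one_mul, e1, e2] at h
  calc ellipticK ((1 - k) ^ 2 / (1 + k) ^ 2)
      = (1 + k) / 2 * (1 / ((1 + k) / 2) * ellipticK ((1 - k) ^ 2 / (1 + k) ^ 2)) := by
        rw [← mul_assoc, one_div, mul_inv_cancel₀ h1k, one_mul]
    _ = (1 + k) / 2 * ellipticK (1 - k ^ 2) := by rw [h, div_one, one_mul]

/-- **Landen (ascending)**: `K(1 - ((1-k)/(1+k))²) = (1+k)·K(k²)`, from Gauss's invariance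
`I(1, √(1-k²)) = I(1+k, 1-k)`. [cite: BorweinBorwein1987, Thm 1.2] -/
theorem ellipticK_landen_one_sub_sq {k : ℝ} (hk0 : 0 < k) (hk1 : k < 1) :
    ellipticK (1 - (1 - k) ^ 2 / (1 + k) ^ 2) = (1 + k) * ellipticK (k ^ 2) := by
  have ha : 0 < 1 + k := by linarith
  have hb : 0 < 1 - k := by linarith
  have h := gaussAGMIntegral_agm_step (a := 1 + k) (b := 1 - k) ha hb
  have e0 : (1 + k + (1 - k)) / 2 = 1 := by ring
  have e2 : (1 + k) * (1 - k) = 1 - k ^ 2 := by ring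
  rw [e0, e2, gaussAGMIntegral_eq_ellipticK one_pos (Real.sqrt_pos.2 (by nlinarith)),
    gaussAGMIntegral_eq_ellipticK ha hb, Real.sq_sqrt (by nlinarith)] at h
  have e1 : 1 - (1 - k ^ 2) / 1 ^ 2 = k ^ 2 := by ring
  rw [e1] at h
  -- `h : 1 / 1 * K(k²) = 1 / (1 + k) * K(1 - (1-k)²/(1+k)²)`
  calc ellipticK (1 - (1 - k) ^ 2 / (1 + k) ^ 2)
      = (1 + k) * (1 / (1 + k) * ellipticK (1 - (1 - k) ^ 2 / (1 + k) ^ 2)) := by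
        rw [← mul_assoc, one_div, mul_inv_cancel₀ ha.ne', one_mul]
    _ = (1 + k) * ellipticK (k ^ 2) := by rw [← h, div_one, one_mul]

/-- **The hypergeometric ratio at the rectangle's cross-ratio is the reciprocal aspect ratio**:
for `0 < k < 1` and `η = ((1-k)/(1+k))²`,
`₂F₁(½,½;1;η)/₂F₁(½,½;1;1-η) = K(1-k²) / (2K(k²))`. [cite: BollobasRiordan2006, Ch. 7 §7.1 p. 185] -/
theorem hypergeometric_ratio_eq {k : ℝ} (hk0 : 0 < k) (hk1 : k < 1) :
    ordinaryHypergeometric (1 / 2 : ℝ) (1 / 2) 1 ((1 - k) ^ 2 / (1 + k) ^ 2) /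
        ordinaryHypergeometric (1 / 2 : ℝ) (1 / 2) 1 (1 - (1 - k) ^ 2 / (1 + k) ^ 2) =
      ellipticK (1 - k ^ 2) / (2 * ellipticK (k ^ 2)) := by
  have hη := crossRatio_modulus_mem_Ioo ⟨hk0, hk1⟩
  have h1 := Literature.NumberTheory.ModularForms.ellipticK_eq_hypergeometric hη.1.le hη.2
  have h2 := Literature.NumberTheory.ModularForms.ellipticK_eq_hypergeometric
    (x := 1 - (1 - k) ^ 2 / (1 + k) ^ 2) (by linarith [hη.2]) (by linarith [hη.1])
  have hpi : Real.pi / 2 ≠ 0 := by positivity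
  have e1 : ordinaryHypergeometric (1 / 2 : ℝ) (1 / 2) 1 ((1 - k) ^ 2 / (1 + k) ^ 2) =
      (Real.pi / 2)⁻¹ * ellipticK ((1 - k) ^ 2 / (1 + k) ^ 2) := by
    rw [h1, ← mul_assoc, inv_mul_cancel₀ hpi, one_mul]
  have e2 : ordinaryHypergeometric (1 / 2 : ℝ) (1 / 2) 1 (1 - (1 - k) ^ 2 / (1 + k) ^ 2) =
      (Real.pi / 2)⁻¹ * ellipticK (1 - (1 - k) ^ 2 / (1 + k) ^ 2) := by
    rw [h2, ← mul_assoc, inv_mul_cancel₀ hpi, one_mul]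
  rw [e1, e2, ellipticK_landen_sq hk0 hk1, ellipticK_landen_one_sub_sq hk0 hk1]
  have hK : 0 < ellipticK (k ^ 2) := ellipticK_sq_pos hk0 hk1
  have hK' : 0 < ellipticK (1 - k ^ 2) := ellipticK_one_sub_sq_pos hk0 hk1
  have h1k : (0 : ℝ) < 1 + k := by linarith
  field_simp

/-! ### §2. The modulus `k` of a uniformizing rectangle is determined by the cross-ratio -/

/-- **Cross-ratio of a conformal rectangle from a rectangle uniformizer.** If `G` maps the
Schwarz–Christoffel rectangle `scrRect k` conformally onto `Ω` with the corners `scrCorner k i`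
going to the marked points `R.pt (τ i)` (`τ = id` or `rev`), then every uniformizing datum
`(φ, x)` of `R` has `crossRatio x = ((1-k)/(1+k))²`: composing `G` with the Schwarz–Christoffel
equivalence `ℍₒ → scrRect k` gives a uniformizing datum with prevertices `(-1/k, -1, 1, 1/k)`
(possibly reversed), and the cross-ratio does not depend on the datum
(`crossRatio_eq_of_isUniformizing_holds`). [cite: AhlforsCA1979, Ch. 6 §2.2] -/
theorem crossRatio_eq_of_uniformizer (R : ConformalRectangle) {k : ℝ} (hk0 : 0 < k) (hk1 : k < 1)
    (G : ConformalEquiv (scrQuad k hk0 hk1).carrier R.carrier) {τ : Fin 4 ≃ Fin 4}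
    (hτ : τ = Equiv.refl _ ∨ τ = Fin.revPerm)
    (hbv : ∀ i, G.HasBoundaryValue (scrCorner k i) (R.pt (τ i)))
    {φ : ConformalEquiv upperHalfPlaneSet R.carrier} {x : Fin 4 → ℝ} (h : R.IsUniformizing φ x) :
    crossRatio x = (1 - k) ^ 2 / (1 + k) ^ 2 := by
  obtain ⟨Φ, hΦ⟩ := exists_scrEquiv hk0 hk1
  have hΦbv : ∀ i, Tendsto Φ (𝓝[upperHalfPlaneSet] ((scrPrevertex k i : ℝ) : ℂ))
      (𝓝[(scrQuad k hk0 hk1).carrier] (scrCorner k i)) := fun i =>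
    tendsto_nhdsWithin_iff.2 ⟨(tendsto_scrFun_scrPrevertex hk0 hk1 i).congr fun z => (hΦ z).symm,
      eventually_nhdsWithin_of_forall fun z hz => Φ.mapsTo hz⟩
  have hcomp : ∀ i, (Φ.trans G).HasBoundaryValue (scrPrevertex k i) (R.pt (τ i)) := fun i => by
    have := (hbv i).comp (hΦbv i)
    exact this
  -- the datum `(Φ.trans G, scrPrevertex k ∘ τ⁻¹)`
  have hdat : R.IsUniformizing (Φ.trans G) (fun i => scrPrevertex k (τ.symm i)) := by
    refine ⟨?_, fun i => ?_⟩
    · rcases hτ with rfl | rfl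
      · exact Or.inl (strictMono_scrPrevertex hk0 hk1)
      · right
        rw [Fin.revPerm_symm]
        intro i j hij
        exact strictMono_scrPrevertex hk0 hk1 (by simpa using hij)
    · have := hcomp (τ.symm i)
      rwa [Equiv.apply_symm_apply] at this
  rw [ConformalRectangle.crossRatio_eq_of_isUniformizing_holds h hdat]
  rcases hτ with rfl | rfl
  · exact crossRatio_scrPrevertex hk0 hk1
  · rw [Fin.revPerm_symm]
    have : (fun i => scrPrevertex k (Fin.revPerm i)) = scrPrevertex k ∘ Fin.rev := rfl
    rw [this, crossRatio_rev]
    exact crossRatio_scrPrevertex hk0 hk1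

/-- **The uniformizing rectangle of a conformal rectangle, with its modulus.** As
`SquareTiling.exists_uniformizer`, together with the identification of the modulus: the
cross-ratio of every uniformizing datum of `R` is `((1-k)/(1+k))²`.
[cite: AhlforsCA1979, Ch. 6 §1.1 Thm. 1] -/
theorem exists_uniformizer_crossRatio (R : ConformalRectangle) :
    ∃ (k : ℝ) (hk0 : 0 < k) (hk1 : k < 1) (G : ConformalEquiv (scrQuad k hk0 hk1).carrier R.carrier)
      (Ψ : ℂ → ℂ) (τ : Fin 4 ≃ Fin 4), (τ = Equiv.refl _ ∨ τ = Fin.revPerm) ∧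
      ContinuousOn Ψ (closure (scrRect k)) ∧ EqOn Ψ G (scrRect k) ∧
      BijOn Ψ (closure (scrRect k)) (closure R.carrier) ∧ MapsTo Ψ (frontier (scrRect k)) (frontier R.carrier) ∧
      (∀ i, Ψ (scrCorner k i) = R.pt (τ i)) ∧
      ∀ (φ : ConformalEquiv upperHalfPlaneSet R.carrier) (x : Fin 4 → ℝ), R.IsUniformizing φ x →
        crossRatio x = (1 - k) ^ 2 / (1 + k) ^ 2 := by
  obtain ⟨k, hk0, hk1, G, Ψ, τ, hτ, hΨc, hΨeq, hΨbij, hΨfr, hcorner⟩ := exists_uniformizer R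
  refine ⟨k, hk0, hk1, G, Ψ, τ, hτ, hΨc, hΨeq, hΨbij, hΨfr, hcorner, fun φ x h => ?_⟩
  refine crossRatio_eq_of_uniformizer R hk0 hk1 G hτ (fun i => ?_) h
  -- boundary values of `G` at the corners from the continuous extension `Ψ`
  have hcar : (scrQuad k hk0 hk1).carrier = scrRect k := scrQuad_carrier hk0 hk1
  have hmem : scrCorner k i ∈ closure (scrRect k) := by
    rw [← hcar]; exact scrCorner_mem_closure hk0 hk1 i
  have h1 : Tendsto Ψ (𝓝[(scrQuad k hk0 hk1).carrier] (scrCorner k i)) (𝓝 (R.pt (τ i))) := by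
    rw [← hcorner i, hcar]
    exact (hΨc _ hmem).mono_left (nhdsWithin_mono _ subset_closure)
  refine h1.congr' (eventually_nhdsWithin_of_forall fun z hz => hΨeq ?_)
  rwa [hcar] at hz


/-! ### §3. The uniformizing rectangle `(0, 2K(k²)) × (0, K(1-k²))` and its sides -/

/-- **Uniformization of a conformal rectangle by the rectangle `(0, 2K(k²)) × (0, K(1-k²))`,
with the modulus identified.** Exactly `SquareTiling.exists_rect_uniformizer` (continuous
injection of the closed rectangle onto `closure Ω`, conformal inside, closed vertical sides into
the arcs `0`, `2` in some order, open sides into the open arcs), for the rectangle of width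
`a = 2K(k²)` and height `b = K(1-k²)`, where `0 < k < 1` is such that every uniformizing datum of
`R` has cross-ratio `((1-k)/(1+k))²`. The proof is that of `exists_rect_uniformizer`, started
from `exists_uniformizer_crossRatio`. [cite: AhlforsCA1979, Ch. 6 §1.1 Thm. 1 and §2.2] -/
theorem exists_rect_uniformizer_modulus (R : ConformalRectangle) :
    ∃ (k : ℝ) (_ : 0 < k) (_ : k < 1) (Ψ : ℂ → ℂ) (jL jR : Fin 4),
      (∀ (φ : ConformalEquiv upperHalfPlaneSet R.carrier) (x : Fin 4 → ℝ), R.IsUniformizing φ x →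
        crossRatio x = (1 - k) ^ 2 / (1 + k) ^ 2) ∧
      ContinuousOn Ψ (Icc 0 (2 * ellipticK (k ^ 2)) ×ℂ Icc 0 (ellipticK (1 - k ^ 2))) ∧
      InjOn Ψ (Icc 0 (2 * ellipticK (k ^ 2)) ×ℂ Icc 0 (ellipticK (1 - k ^ 2))) ∧
      Ψ '' (Icc 0 (2 * ellipticK (k ^ 2)) ×ℂ Icc 0 (ellipticK (1 - k ^ 2))) = closure R.carrier ∧
      Ψ '' (Ioo 0 (2 * ellipticK (k ^ 2)) ×ℂ Ioo 0 (ellipticK (1 - k ^ 2))) = R.carrier ∧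
      DifferentiableOn ℂ Ψ (Ioo 0 (2 * ellipticK (k ^ 2)) ×ℂ Ioo 0 (ellipticK (1 - k ^ 2))) ∧
      (∀ z ∈ Ioo 0 (2 * ellipticK (k ^ 2)) ×ℂ Ioo 0 (ellipticK (1 - k ^ 2)), deriv Ψ z ≠ 0) ∧
      ((jL = 0 ∧ jR = 2) ∨ (jL = 2 ∧ jR = 0)) ∧
      Ψ '' ({0} ×ℂ Icc 0 (ellipticK (1 - k ^ 2))) ⊆ R.arc jL ∧
      Ψ '' ({2 * ellipticK (k ^ 2)} ×ℂ Icc 0 (ellipticK (1 - k ^ 2))) ⊆ R.arc jR ∧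
      Ψ '' ({0} ×ℂ Ioo 0 (ellipticK (1 - k ^ 2))) ⊆ openArc R jL ∧
      Ψ '' ({2 * ellipticK (k ^ 2)} ×ℂ Ioo 0 (ellipticK (1 - k ^ 2))) ⊆ openArc R jR ∧
      Ψ '' (Ioo 0 (2 * ellipticK (k ^ 2)) ×ℂ {0}) ⊆ openArc R 1 ∧
      Ψ '' (Ioo 0 (2 * ellipticK (k ^ 2)) ×ℂ {ellipticK (1 - k ^ 2)}) ⊆ openArc R 3 := by
  obtain ⟨k, hk0, hk1, G, Ψ, τ, hτ, hΨc, hΨeq, hΨbij, hΨfr, hcorner, hcr⟩ :=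
    exists_uniformizer_crossRatio R
  set K := ellipticK (k ^ 2) with hK
  set K' := ellipticK (1 - k ^ 2) with hK'
  have hKp : 0 < K := ellipticK_sq_pos hk0 hk1
  have hK'p : 0 < K' := ellipticK_one_sub_sq_pos hk0 hk1
  have hrect : scrRect k = Ioo (-K) K ×ℂ Ioo 0 K' := rfl
  have hcl : closure (scrRect k) = Icc (-K) K ×ℂ Icc 0 K' := by
    rw [hrect, closure_reProdIm, closure_Ioo (by linarith), closure_Ioo hK'p.ne]
  -- corner coordinates
  have hc0 : scrCorner k 0 = (-K : ℝ) + (K' : ℝ) * I := by simp [scrCorner, hK, hK']; ring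
  have hc1 : scrCorner k 1 = (-K : ℝ) + (0 : ℝ) * I := by simp [scrCorner, hK]
  have hc2 : scrCorner k 2 = (K : ℝ) + (0 : ℝ) * I := by simp [scrCorner, hK]
  have hc3 : scrCorner k 3 = (K : ℝ) + (K' : ℝ) * I := by simp [scrCorner, hK, hK']; ring
  have hcornerre : ∀ i, (scrCorner k i).re = -K ∨ (scrCorner k i).re = K := by
    intro i; fin_cases i <;> simp [hc0, hc1, hc2, hc3]
  have hcornerim : ∀ i, (scrCorner k i).im = 0 ∨ (scrCorner k i).im = K' := by
    intro i; fin_cases i <;> simp [hc0, hc1, hc2, hc3]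
  have hwitV : ∀ (x y : ℝ) (s : Set ℝ), ((x : ℂ) + (y : ℂ) * I ∈ ({x} ×ℂ s : Set ℂ)) ↔ y ∈ s := by
    intro x y s; simp [mem_reProdIm]
  have hwitH : ∀ (x y : ℝ) (s : Set ℝ), ((x : ℂ) + (y : ℂ) * I ∈ (s ×ℂ {y} : Set ℂ)) ↔ x ∈ s := by
    intro x y s; simp [mem_reProdIm]
  -- the four open sides and their arcs
  have hside : ∀ (S : Set ℂ), IsPreconnected S → S ⊆ frontier (scrRect k) → (∀ i, scrCorner k i ∉ S) → S.Nonempty →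
      ∀ i j : Fin 4, i ≠ j → scrCorner k i ∈ closure S → scrCorner k j ∈ closure S →
      ∃ m, Ψ '' S ⊆ openArc R m ∧ ((τ i = m ∧ τ j = m + 1) ∨ (τ j = m ∧ τ i = m + 1)) :=
    fun S hS hSf hSc hSne i j hij hi hj =>
      exists_image_subset_openArc R hk0 hk1 hΨc hΨbij hΨfr hcorner hS hSf hSc hSne
        (fun h => hij (τ.injective h)) hi hj
  -- left side: corners 1 (bottom) and 0 (top)
  obtain ⟨mL, hL, hmL⟩ := hside ({-K} ×ℂ Ioo 0 K') (isPreconnected_vSeg _ _ isPreconnected_Ioo)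
    (fun z hz => by
      rw [mem_reProdIm, mem_singleton_iff] at hz
      rw [hrect, frontier_rect (by linarith) hK'p]
      exact Or.inr ⟨Or.inl hz.1, Ioo_subset_Icc_self hz.2⟩)
    (fun i hi => by
      rw [mem_reProdIm] at hi
      rcases hcornerim i with h | h <;> [exact (lt_irrefl _ (h ▸ hi.2.1)); exact (lt_irrefl _ (h ▸ hi.2.2))])
    ⟨_, (hwitV (-K) (K' / 2) _).2 ⟨by linarith, by linarith⟩⟩
    1 0 (by decide)
    (by rw [closure_reProdIm, closure_Ioo hK'p.ne, hc1, mem_reProdIm]; simp [hK'p.le])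
    (by rw [closure_reProdIm, closure_Ioo hK'p.ne, hc0, mem_reProdIm]; simp [hK'p.le])
  -- right side: corners 2 and 3
  obtain ⟨mR, hR, hmR⟩ := hside ({K} ×ℂ Ioo 0 K') (isPreconnected_vSeg _ _ isPreconnected_Ioo)
    (fun z hz => by
      rw [mem_reProdIm, mem_singleton_iff] at hz
      rw [hrect, frontier_rect (by linarith) hK'p]
      exact Or.inr ⟨Or.inr hz.1, Ioo_subset_Icc_self hz.2⟩)
    (fun i hi => by
      rw [mem_reProdIm] at hi
      rcases hcornerim i with h | h <;> [exact (lt_irrefl _ (h ▸ hi.2.1)); exact (lt_irrefl _ (h ▸ hi.2.2))])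
    ⟨_, (hwitV K (K' / 2) _).2 ⟨by linarith, by linarith⟩⟩
    2 3 (by decide)
    (by rw [closure_reProdIm, closure_Ioo hK'p.ne, hc2, mem_reProdIm]; simp [hK'p.le])
    (by rw [closure_reProdIm, closure_Ioo hK'p.ne, hc3, mem_reProdIm]; simp [hK'p.le])
  -- bottom side: corners 1 and 2
  obtain ⟨mB, hB, hmB⟩ := hside (Ioo (-K) K ×ℂ {0}) (isPreconnected_hSeg _ _ isPreconnected_Ioo)
    (fun z hz => by
      rw [mem_reProdIm, mem_singleton_iff] at hz
      rw [hrect, frontier_rect (by linarith) hK'p]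
      exact Or.inl ⟨Ioo_subset_Icc_self hz.1, Or.inl hz.2⟩)
    (fun i hi => by
      rw [mem_reProdIm] at hi
      rcases hcornerre i with h | h <;> [exact (lt_irrefl _ (h ▸ hi.1.1)); exact (lt_irrefl _ (h ▸ hi.1.2))])
    ⟨_, (hwitH 0 0 _).2 ⟨by linarith, by linarith⟩⟩
    1 2 (by decide)
    (by rw [closure_reProdIm, closure_Ioo (by linarith), hc1, mem_reProdIm]; simp [hKp.le])
    (by rw [closure_reProdIm, closure_Ioo (by linarith), hc2, mem_reProdIm]; simp [hKp.le])
  -- top side: corners 3 and 0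
  obtain ⟨mT, hT, hmT⟩ := hside (Ioo (-K) K ×ℂ {K'}) (isPreconnected_hSeg _ _ isPreconnected_Ioo)
    (fun z hz => by
      rw [mem_reProdIm, mem_singleton_iff] at hz
      rw [hrect, frontier_rect (by linarith) hK'p]
      exact Or.inl ⟨Ioo_subset_Icc_self hz.1, Or.inr hz.2⟩)
    (fun i hi => by
      rw [mem_reProdIm] at hi
      rcases hcornerre i with h | h <;> [exact (lt_irrefl _ (h ▸ hi.1.1)); exact (lt_irrefl _ (h ▸ hi.1.2))])
    ⟨_, (hwitH 0 K' _).2 ⟨by linarith, by linarith⟩⟩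
    3 0 (by decide)
    (by rw [closure_reProdIm, closure_Ioo (by linarith), hc3, mem_reProdIm]; simp [hKp.le])
    (by rw [closure_reProdIm, closure_Ioo (by linarith), hc0, mem_reProdIm]; simp [hKp.le])
  -- identify the arcs
  have hvals : ((mL = 0 ∧ mR = 2) ∨ (mL = 2 ∧ mR = 0)) ∧ mB = 1 ∧ mT = 3 := by
    rcases hτ with rfl | rfl
    · simp only [Equiv.refl_apply] at hmL hmR hmB hmT
      refine ⟨Or.inl ⟨?_, ?_⟩, ?_, ?_⟩ <;> omega
    · simp only [Fin.revPerm_apply] at hmL hmR hmB hmT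
      have r0 : Fin.rev (0 : Fin 4) = 3 := rfl
      have r1 : Fin.rev (1 : Fin 4) = 2 := rfl
      have r2 : Fin.rev (2 : Fin 4) = 1 := rfl
      have r3 : Fin.rev (3 : Fin 4) = 0 := rfl
      rw [r0, r1] at hmL; rw [r2, r3] at hmR; rw [r1, r2] at hmB; rw [r3, r0] at hmT
      refine ⟨Or.inr ⟨?_, ?_⟩, ?_, ?_⟩ <;> omega
  obtain ⟨hLR, rfl, rfl⟩ := hvals
  -- translate to `(0, 2K) × (0, K')`
  set T : ℂ → ℂ := fun z => z - K with hTdef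
  have hT_Icc : T '' (Icc 0 (2 * K) ×ℂ Icc 0 K') = Icc (-K) K ×ℂ Icc 0 K' := by
    ext z; simp only [hTdef, mem_image, mem_reProdIm, mem_Icc]
    constructor
    · rintro ⟨w, ⟨⟨h1, h2⟩, h3, h4⟩, rfl⟩; simp; refine ⟨⟨?_, ?_⟩, h3, h4⟩ <;> linarith
    · rintro ⟨⟨h1, h2⟩, h3, h4⟩; refine ⟨z + K, ⟨⟨?_, ?_⟩, ?_, ?_⟩, by ring⟩ <;> simp <;> linarith
  have hT_Ioo : T '' (Ioo 0 (2 * K) ×ℂ Ioo 0 K') = Ioo (-K) K ×ℂ Ioo 0 K' := by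
    ext z; simp only [hTdef, mem_image, mem_reProdIm, mem_Ioo]
    constructor
    · rintro ⟨w, ⟨⟨h1, h2⟩, h3, h4⟩, rfl⟩; simp; refine ⟨⟨?_, ?_⟩, h3, h4⟩ <;> linarith
    · rintro ⟨⟨h1, h2⟩, h3, h4⟩; refine ⟨z + K, ⟨⟨?_, ?_⟩, ?_, ?_⟩, by ring⟩ <;> simp <;> linarith
  have hT_maps : ∀ (s : Set ℝ) (t : Set ℝ) (s' : Set ℝ), (∀ x, x ∈ s ↔ x - K ∈ s') → T '' (s ×ℂ t) = s' ×ℂ t := by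
    intro s t s' h
    ext z; simp only [hTdef, mem_image, mem_reProdIm]
    constructor
    · rintro ⟨w, ⟨h1, h2⟩, rfl⟩; simp; exact ⟨(h _).1 h1, h2⟩
    · rintro ⟨h1, h2⟩
      refine ⟨z + K, ⟨(h _).2 (by simpa using h1), by simpa using h2⟩, by ring⟩
  have hTc : Continuous T := by fun_prop
  have hGΨ : EqOn Ψ G (scrRect k) := hΨeq
  have hGdiff : DifferentiableOn ℂ Ψ (scrRect k) :=
    (G.differentiableOn_coe.mono (scrQuad_carrier hk0 hk1).symm.subset).congr hGΨ
  have hGbij : BijOn G (scrRect k) R.carrier :=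
    (congrArg (fun S => BijOn G S R.carrier) (scrQuad_carrier hk0 hk1)).mp G.bijOn
  have hopen' : IsOpen (scrQuad k hk0 hk1).carrier := by rw [scrQuad_carrier]; exact isOpen_Ioo.reProdIm isOpen_Ioo
  have hopen : IsOpen (scrRect k) := isOpen_Ioo.reProdIm isOpen_Ioo
  refine ⟨k, hk0, hk1, Ψ ∘ T, mL, mR, hcr, ?_, ?_, ?_, ?_, ?_, ?_, hLR, ?_, ?_, ?_, ?_, ?_, ?_⟩
  · refine hΨc.comp hTc.continuousOn fun z hz => ?_
    rw [hcl, ← hT_Icc]; exact mem_image_of_mem T hz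
  · intro z hz w hw h
    have hz' : T z ∈ closure (scrRect k) := by rw [hcl, ← hT_Icc]; exact mem_image_of_mem T hz
    have hw' : T w ∈ closure (scrRect k) := by rw [hcl, ← hT_Icc]; exact mem_image_of_mem T hw
    have := hΨbij.injOn hz' hw' h
    simpa [hTdef] using this
  · rw [image_comp, hT_Icc, ← hcl]; exact hΨbij.image_eq
  · rw [image_comp, hT_Ioo, ← hrect, hGΨ.image_eq]; exact hGbij.image_eq
  · refine hGdiff.comp (by fun_prop) fun z hz => ?_
    rw [hrect, ← hT_Ioo]; exact mem_image_of_mem T hz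
  · intro z hz
    have hz' : T z ∈ scrRect k := by rw [hrect, ← hT_Ioo]; exact mem_image_of_mem T hz
    have hd : deriv (Ψ ∘ T) z = deriv Ψ (T z) := by
      show deriv (fun w => Ψ (w - K)) z = _
      exact deriv_comp_sub_const Ψ _ _
    rw [hd, (hGΨ.eventuallyEq_of_mem (hopen.mem_nhds hz')).deriv_eq]
    have hz'' : T z ∈ (scrQuad k hk0 hk1).carrier := by rw [scrQuad_carrier]; exact hz'
    exact Literature.Analysis.Complex.SCV.deriv_ne_zero_of_injOn G.differentiableOn_coe hopen' G.injOn hz''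
  · -- closed left side: image of the closure of the open side
    rw [image_comp, hT_maps {0} (Icc 0 K') {-K} (fun x => by simp only [mem_singleton_iff]; constructor <;> intro h <;> linarith)]
    have h1 : ({-K} ×ℂ Icc 0 K' : Set ℂ) = closure ({-K} ×ℂ Ioo 0 K') := by
      rw [closure_reProdIm, closure_Ioo hK'p.ne, closure_singleton]
    rw [h1]
    have hsub : closure ({-K} ×ℂ Ioo 0 K') ⊆ closure (scrRect k) := by
      rw [← h1, hcl]; intro z hz; rw [mem_reProdIm] at hz ⊢; simp at hz; exact ⟨by rw [hz.1]; constructor <;> linarith, hz.2⟩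
    exact ((hΨc.mono hsub).image_closure).trans ((R.isClosed_arc mL).closure_subset_iff.2 (hL.trans (openArc_subset_arc R mL)))
  · rw [image_comp, hT_maps {2 * K} (Icc 0 K') {K} (fun x => by simp only [mem_singleton_iff]; constructor <;> intro h <;> linarith)]
    have h1 : ({K} ×ℂ Icc 0 K' : Set ℂ) = closure ({K} ×ℂ Ioo 0 K') := by
      rw [closure_reProdIm, closure_Ioo hK'p.ne, closure_singleton]
    rw [h1]
    have hsub : closure ({K} ×ℂ Ioo 0 K') ⊆ closure (scrRect k) := by
      rw [← h1, hcl]; intro z hz; rw [mem_reProdIm] at hz ⊢; simp at hz; exact ⟨by rw [hz.1]; constructor <;> linarith, hz.2⟩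
    exact ((hΨc.mono hsub).image_closure).trans ((R.isClosed_arc mR).closure_subset_iff.2 (hR.trans (openArc_subset_arc R mR)))
  · rw [image_comp, hT_maps {0} (Ioo 0 K') {-K} (fun x => by simp only [mem_singleton_iff]; constructor <;> intro h <;> linarith)]
    exact hL
  · rw [image_comp, hT_maps {2 * K} (Ioo 0 K') {K} (fun x => by simp only [mem_singleton_iff]; constructor <;> intro h <;> linarith)]
    exact hR
  · rw [image_comp, hT_maps (Ioo 0 (2 * K)) {0} (Ioo (-K) K) (fun x => by simp only [mem_Ioo]; constructor <;> rintro ⟨h1, h2⟩ <;> constructor <;> linarith)]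
    exact hB
  · rw [image_comp, hT_maps (Ioo 0 (2 * K)) {K'} (Ioo (-K) K) (fun x => by simp only [mem_Ioo]; constructor <;> rintro ⟨h1, h2⟩ <;> constructor <;> linarith)]
    exact hT

end ModulusIdentification

end Summit.CriticalPhenomena.CardyFormulaZ2.Theorems
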